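import Summits.BirchSwinnertonDyer.BirchSwinnertonDyer.Theorems.ByReductionTypeAtTwoTorsionEulerCharExactOfReverse
import HarnessLib

set_option linter.dupNamespace false -- `…BirchSwinnertonDyer.BirchSwinnertonDyer…` is the cell's nested layout (D-0017)
set_option autoImplicit false

/-!
# Greenberg LNM 1716 Theorem 4.1 over `ℚ` WITH RATIONAL `p`-TORSION, TWO-SIDED modulo the displayed REVERSE INEQUALITY of
# Lemma 4.7 — part 2: the PRINTED / `ℚ_p` / display currencies (`X5.O1.TwoAdicEulerCharRankZero W 0`,
# `X5.O1.TwoAdicEulerCharRankZeroNonsplitMult W 0`)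

Cell `bsd-2adic` (run/shared/lean/pub/bsd-2adic/), seat `bsd-2adic-tower-1` GEN 33; `--supports stmt-BirchSwinnertonDyer-19271`
(helper for the GOOD-ORDINARY rows at `2` WITH a rational `2`-torsion point, whose doors display `hEC : X5.O1.TwoAdicEulerCharRankZero
W 0`). THEOREMS ONLY (no definition, no named fact, no `sorry`); closes no item; nothing booked; no display re-keyed (D-0152); BSD
is not proved by any of this.

R. Greenberg, *Iwasawa theory for elliptic curves*, LNM 1716 (1999), Thm. 4.1 (p. 102) and its multiplicative analogue (p. 112):
`f_E(0) ∼ (∏_v l_v c_v^{(p)}) (∏_{v∣p} |Ẽ_v(f_v)_p|²) |Sel_E(F)_p| / |E(F)_p|²`. With `E(F)_p ≠ 0` the printed proof is Lemmas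
4.2/4.3 × Lemma 4.7 `|ker g|·|E(F)_p| = |ker r|·|(Sel_E(F_∞)_p)_Γ|` × Cassels' count `[𝒫^Σ(F) : 𝒢^Σ(F)] = |E(F)_p|`. In the tree:
Lemmas 4.2/4.3 (`SelmerDualData.constantCoeff_charGenerator_mul_natCard_of_finite_selmerGroup_rat`), the «`≥`» half of Lemma 4.7
(GEN 31 part 3c `prod_natCard_mul_natCard_endCoinvariants_le`) and Cassels' count at one auxiliary place `v₀` WITH torsion
(GEN 32 part 11 `natCard_cokernel_eq`: `#C_{v₀} = #E(K)(p)`, `C_{v₀} = H¹(Γ_{K_{v₀}}, E)(p) / loc_{v₀}(U)`) are KERNEL theorems for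
every `p`. The «`≤`» half of Lemma 4.7,

  «REV(W, p, κ, γ, S, v₀)»: `#(A₀/Sel₀) · #C_{v₀} ≤ (∏_{v ∈ S} #𝒦_{v,0}[p^∞]) · #(Sel_{p^∞}(E/ℚ_∞))_γ`,

is Greenberg's map `t` (GEN 32 parts 7–9) and needs his Lemma 4.6 on `Γ`-invariants at `v₀` (the displayed binder `h46` of part
9, `…TorsionEulerCharReverse`). The prequel `…TorsionEulerCharExactOfReverse` takes REV itself as a DISPLAYED HYPOTHESIS `hrev` and
proves the two-sided count `f(0)·#E(ℚ)(p)² = u·#Sel·∏_{v∈S} #𝒦_{v,0}[p^∞]`, `u ∈ ℤ_pˣ`, at a good ordinary and at a non-split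
multiplicative `p`. THIS FILE converts it into the printed and display currencies:

* **`constantCoeff_mul_sq_eq_printed_of_reverse`** — printed currency: `f(0)·#E(ℚ)(p)² = u·p^{ord_p ∏_ℓ c_ℓ}·(p^{ord_p #Ẽ(𝔽_p)})²·#Sel`;
* **`charValue_rankZero_of_reverse`** — the EXACT `ℚ_p`-currency of the named fact `greenberg_charValue_rankZero` / of the display
  `X5.O1.TwoAdicEulerCharRankZero W 0`, modulo `hrev` ALONE;
* **`twoAdicEulerCharRankZero_of_reverse`** — `(∀ κ γ cyclotomic, ∃ S v₀, REV) → X5.O1.TwoAdicEulerCharRankZero W 0`;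
* **`constantCoeff_mul_sq_eq_two_nonsplit_of_reverse`**, **`twoAdicEulerCharRankZeroNonsplitMult_of_reverse`** — the NON-SPLIT
  multiplicative twins (`l_v = 2` at `p = 2`: `f(0)·#E(ℚ)(2)² = u·2^{ord₂ ∏_ℓ c_ℓ + 1}·#Sel`, `u ∈ ℤ₂ˣ`).

HONEST FRAMING: REV is NOT proved here (it is Lemma 4.7's «`≤`» half = Lemma 4.6 on `Γ`-invariants; part 9 derives it from the
displayed `h46`); everything else is kernel-checked over tree theorems. Closes no item; no summit statement is proved; the
Birch–Swinnerton-Dyer conjecture is NOT proved by any of this.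

References: [GreenbergLNM1716] Thm. 4.1 (p. 102), §3 Lemmas 3.3–3.4 (pp. 86–89), §4 pp. 104–108 (Lemmas 4.6–4.7), pp. 112–113,
Prop. 4.13 (pp. 121–122).
-/

noncomputable section

open scoped Classical NumberField

open NumberField IsDedekindDomain Field

namespace Summit.BirchSwinnertonDyer.BirchSwinnertonDyer.Theorems.TorsionEulerChar

open Literature.NumberTheory.EllipticCurves Literature.NumberTheory.GaloisRepresentations
  WeierstrassCurve ZpExtension Literature.NumberTheory.EllipticCurves.IwasawaAlgebra
  Literature.NumberTheory.EllipticCurves.IwasawaDual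
  Literature.NumberTheory.EllipticCurves.GreenbergVatsal2000 Literature.NumberTheory.EllipticCurves.GreenbergSelmer
  Literature.NumberTheory.EllipticCurves.Rank1Residual Summit.BirchSwinnertonDyer.Rank1Residual.X2

/-! ## §0 Arithmetic helpers (copies of the private helpers of parts 4/6/A) -/

/-- `ord_p` of a product of non-zero naturals is the sum of the `ord_p`. [folklore] -/
private theorem padicValNat_prod {ι : Type*} (p : ℕ) [Fact p.Prime] (s : Finset ι) (f : ι → ℕ)
    (hf : ∀ i ∈ s, f i ≠ 0) : padicValNat p (∏ i ∈ s, f i) = ∑ i ∈ s, padicValNat p (f i) := by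
  induction s using Finset.induction_on with
  | empty => simp
  | insert a s ha ih =>
    rw [Finset.prod_insert ha, Finset.sum_insert ha,
      padicValNat.mul (hf a (Finset.mem_insert_self a s))
        (Finset.prod_ne_zero_iff.mpr fun i hi ↦ hf i (Finset.mem_insert_of_mem hi)),
      ih fun i hi ↦ hf i (Finset.mem_insert_of_mem hi)]

/-- Over `ℚ` a finite place containing the prime `p` is THE place of `p`. [folklore] -/
private theorem eq_of_natCast_mem {p : ℕ} (hp : p.Prime) {v w : HeightOneSpectrum (𝓞 ℚ)}
    (hv : ((p : ℕ) : 𝓞 ℚ) ∈ v.asIdeal) (hw : ((p : ℕ) : 𝓞 ℚ) ∈ w.asIdeal) : v = w :=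
  Rat.HeightOneSpectrum.primesEquiv.injective (Subtype.ext
    ((Rat.HeightOneSpectrum.primesEquiv_eq_of_natCast_mem v hp hv).trans
      (Rat.HeightOneSpectrum.primesEquiv_eq_of_natCast_mem w hp hw).symm))

/-- The local Tamagawa number of `W/ℚ` at a finite place is non-zero (Silverman, *AEC*, Cor. VII.6.2).
[cite: SilvermanAEC2009, VII.6 Cor. 6.2] -/
private theorem localTamagawaNumber_ne_zero_rat (W : WeierstrassCurve ℚ) [W.IsElliptic] (v : HeightOneSpectrum (𝓞 ℚ)) :
    (W.baseChange (v.adicCompletion ℚ)).localTamagawaNumber (v.adicCompletionIntegers ℚ) ≠ 0 := by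
  haveI : Fact (Nat.Prime (Rat.HeightOneSpectrum.primesEquiv v : ℕ)) := ⟨(Rat.HeightOneSpectrum.primesEquiv v).2⟩
  rw [← localTamagawaNumber_padic_eq_holds W v (Rat.HeightOneSpectrum.primesEquiv v : ℕ) rfl]
  exact localTamagawaNumber_padic_ne_zero_holds (Rat.HeightOneSpectrum.primesEquiv v : ℕ) (W.baseChange ℚ_[Rat.HeightOneSpectrum.primesEquiv v])

/-! ## §1 The printed currency: `∏_{v ∈ S} #𝒦_{v,0}[p^∞] = p^{ord_p ∏_ℓ c_ℓ} · (p^{ord_p #Ẽ(𝔽_p)})²` -/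

/-- **Greenberg's Thm. 4.1 over `ℚ`, PRINTED SHAPE, TWO-SIDED, EVERY good ordinary `p`, ANY rational `p`-torsion, modulo the
reverse inequality at one auxiliary place:** for `W/ℚ` globally minimal and elliptic with `GoodOrd W p`, `κ` cyclotomic with
topological generator `γ`, `D` a dual datum with `char X = (f)`, `Sel_{p^∞}(E/ℚ)` finite, `S ⊇ {bad} ∪ {p}` off which `E` is good
and `v ∤ p`, `v₀ ∉ S` and `hrev` = REV(W, p, κ, γ, S, v₀): `X` is finitely generated `Λ`-torsion and
**`f(0) · #E(ℚ)(p)² = u · p^{ord_p ∏_ℓ c_ℓ} · (p^{ord_p #Ẽ(𝔽_p)})² · #Sel_{p^∞}(E/ℚ)` with `u ∈ ℤ_pˣ`** — EXACTLY the printed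
display. Local orders: Lemma 3.4 at `n = 0` (`InputsGreenbergLemma34.natCard_localTowerKerPrimary_zero_eq_pow_sq_rat`) at `v ∋ p`,
Lemma 3.3 exact (`Rank1Residual.Additive.natCard_localTowerKerPrimary_zero_eq_pow_of_isCyclotomic`) at `v ∤ p`, `c_v = 1` off `S`.
[cite: GreenbergLNM1716, Thm. 4.1 (p. 102), §3 Lemmas 3.3–3.4 (pp. 86–89), §4 pp. 104–108] -/
theorem constantCoeff_mul_sq_eq_printed_of_reverse (p : ℕ) [hp : Fact p.Prime] (W : WeierstrassCurve ℚ)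
    [W.IsGloballyMinimal] [W.IsElliptic] (hgo : GoodOrd W p) (κ : ZpExtension ℚ p) (hκ : κ.IsCyclotomic)
    {γ : absoluteGaloisGroup ℚ} (hγ : κ.IsTopGenerator γ) (D : W.SelmerDualData κ γ) [Finite (W.selmerGroupPInfty p)]
    (S : Finset (HeightOneSpectrum (𝓞 ℚ))) (hS : ∀ v ∉ S, ((p : ℕ) : 𝓞 ℚ) ∉ v.asIdeal ∧ W.HasGoodReductionAt v)
    (v₀ : HeightOneSpectrum (𝓞 ℚ)) (hv₀ : v₀ ∉ S)
    (hrev : Nat.card (W.KerG κ 0) *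
        Nat.card (AddCommGroup.primaryComponent
            (discreteH1 (localSubgroup (⊤ : Subgroup (absoluteGaloisGroup ℚ)) (v₀.adicCompletion ℚ))
              (localPoints W (v₀.adicCompletion ℚ))) p ⧸
          (AddSubgroup.map (W.localResOver p ⊤ (v₀.adicCompletion ℚ))
            (unramifiedOutside (⊤ : Subgroup (absoluteGaloisGroup ℚ)) (W.geomPrimaryTorsion p) p
                ((↑S : Set (HeightOneSpectrum (𝓞 ℚ))) ∪ {v₀}) ⊓
              (⨅ v ∈ S, W.localKerOver p ⊤ (v.adicCompletion ℚ)) ⊓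
              (⨅ w : InfinitePlace ℚ, W.localKerOver p ⊤ w.Completion))).addSubgroupOf
            (AddCommGroup.primaryComponent
              (discreteH1 (localSubgroup (⊤ : Subgroup (absoluteGaloisGroup ℚ)) (v₀.adicCompletion ℚ))
                (localPoints W (v₀.adicCompletion ℚ))) p)) ≤
      (∏ v ∈ S, Nat.card (W.localTowerKerPrimary κ (v.adicCompletion ℚ) 0)) *
        Nat.card (EndCoinvariants (W.conjSelmerInfty κ γ - 1)))
    (f : IwasawaAlgebra p) (hf : Module.charIdeal (IwasawaAlgebra p) D.X = Ideal.span {f}) :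
    Module.Finite (IwasawaAlgebra p) D.X ∧ Module.IsTorsion (IwasawaAlgebra p) D.X ∧
      ∃ u : ℤ_[p]ˣ, PowerSeries.constantCoeff f *
          (Nat.card (AddCommGroup.primaryComponent W.toAffine.Point p) : ℤ_[p]) ^ 2 =
        (u : ℤ_[p]) * (p ^ padicValNat p W.tamagawaProduct : ℕ) * ((p ^ padicValNat p (W.reductionPointCount p)) ^ 2 : ℕ) *
          Nat.card (W.selmerGroupPInfty p) := by
  -- adapted from `constantCoeff_mul_sq_eq_printed_upper` (GEN 32 part A, §3) with the given `S`, `v₀` and a unit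
  obtain ⟨hFG, hX, u, hu⟩ := constantCoeff_mul_sq_eq_ordinary_rat_of_reverse p W hgo κ hκ hγ D S hS v₀ hv₀ hrev f hf
  refine ⟨hFG, hX, u, ?_⟩
  rw [hu, mul_assoc, mul_assoc, mul_assoc, mul_comm (Nat.card (W.selmerGroupPInfty p) : ℤ_[p])]
  congr 1
  have hprime : p.Prime := hp.out
  -- the place `v_p` of `p` lies in `S`
  set vp : HeightOneSpectrum (𝓞 ℚ) := Rat.HeightOneSpectrum.primesEquiv.symm ⟨p, hprime⟩ with hvpdef
  have hvp : ((p : ℕ) : 𝓞 ℚ) ∈ vp.asIdeal := by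
    have h := Rat.HeightOneSpectrum.natCast_natGenerator_mem vp
    have hgen : Rat.HeightOneSpectrum.natGenerator vp = p := by
      change ((Rat.HeightOneSpectrum.primesEquiv vp : Nat.Primes) : ℕ) = p
      rw [hvpdef, Equiv.apply_symm_apply]
    rwa [hgen] at h
  have hvpS : vp ∈ S := by
    by_contra h
    exact (hS vp h).1 hvp
  have hgoodS : ∀ v ∉ S, W.HasGoodReductionAt v := fun v hv ↦ (hS v hv).2
  -- evaluate the local orders
  let c : HeightOneSpectrum (𝓞 ℚ) → ℕ := fun v ↦
    (W.baseChange (v.adicCompletion ℚ)).localTamagawaNumber (v.adicCompletionIntegers ℚ)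
  have hsplit := Finset.mul_prod_erase S (fun v ↦ Nat.card (W.localTowerKerPrimary κ (v.adicCompletion ℚ) 0)) hvpS
  have hne : ∀ v ∈ S.erase vp, ((p : ℕ) : 𝓞 ℚ) ∉ v.asIdeal := fun v hv hpv ↦
    (Finset.mem_erase.mp hv).1 (eq_of_natCast_mem hprime hpv hvp)
  have herase : ∏ v ∈ S.erase vp, Nat.card (W.localTowerKerPrimary κ (v.adicCompletion ℚ) 0) =
      p ^ ∑ v ∈ S.erase vp, padicValNat p (c v) := by
    rw [← Finset.prod_pow_eq_pow_sum]
    refine Finset.prod_congr rfl fun v hv ↦ ?_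
    exact Rank1Residual.Additive.natCard_localTowerKerPrimary_zero_eq_pow_of_isCyclotomic W hκ (hne v hv)
  -- `∑_{v ∈ S} ord_p c_v = ord_p ∏_ℓ c_ℓ`, and `c_{v_p} = 1` (good reduction at `p`)
  have htam : W.tamagawaProduct = ∏ v ∈ S, c v := by
    have hsupp : (Function.mulSupport c) ⊆ (S : Set (HeightOneSpectrum (𝓞 ℚ))) := by
      intro v hv
      by_contra hvS
      exact hv (W.localTamagawaNumber_eq_one_of_hasGoodReductionAt_holds v (hgoodS v hvS))
    change ∏ᶠ v, c v = _
    rw [finprod_eq_prod_of_mulSupport_subset c hsupp]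
  have hsum : padicValNat p (c vp) + ∑ v ∈ S.erase vp, padicValNat p (c v) = padicValNat p W.tamagawaProduct := by
    rw [htam, padicValNat_prod p _ c fun v _ ↦ localTamagawaNumber_ne_zero_rat W v, ← Finset.add_sum_erase S _ hvpS]
  have hcvp : c vp = 1 := by
    have hgood : W.HasGoodReductionAt vp := W.hasGoodReductionAt_of_hasGoodReductionAtPrime vp hvp hgo.1
    exact W.localTamagawaNumber_eq_one_of_hasGoodReductionAt_holds vp hgood
  have hsum' : ∑ v ∈ S.erase vp, padicValNat p (c v) = padicValNat p W.tamagawaProduct := by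
    rw [← hsum, hcvp, padicValNat_one_right, zero_add]
  have hcp : Nat.card (W.localTowerKerPrimary κ (vp.adicCompletion ℚ) 0) =
      (p ^ padicValNat p (W.reductionPointCount p)) ^ 2 :=
    InputsGreenbergLemma34.natCard_localTowerKerPrimary_zero_eq_pow_sq_rat W hgo κ hκ vp hvp
  rw [← hsplit, herase, hcp, hsum']
  push_cast
  ring

/-! ## §2 The exact `ℚ_p`-currency of `greenberg_charValue_rankZero` / `X5.O1.TwoAdicEulerCharRankZero W 0` -/

/-- **The TWO-SIDED display in the EXACT currency of the named fact `greenberg_charValue_rankZero` (and, at `p = 2`, of the display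
`X5.O1.TwoAdicEulerCharRankZero W 0`), modulo the reverse inequality at one auxiliary place ALONE:** for `W/ℚ` globally minimal
and elliptic, `GoodOrd W p`, `κ` cyclotomic with topological generator `γ`, `D` a dual datum, `char X = (fE)`, `Sel_{p^∞}(E/ℚ)`
finite, `S ⊇ {bad} ∪ {p}`, `v₀ ∉ S`, REV(W, p, κ, γ, S, v₀): **`∃ u ∈ ℤ_pˣ`, `fE(0) · #E(ℚ)(p)² = u · p^{ord_p ∏_ℓ c_ℓ} ·
#Ẽ(𝔽_p)(p)² · #Sel_{p^∞}(E/ℚ)`** in `ℚ_p` — NO hypothesis on `E(ℚ)[p]`, no `p ≠ 2`.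
(`#Ẽ(𝔽_p)(p) = p^{ord_p #Ẽ(𝔽_p)}`: k4-p1 `InputsGreenbergCharValue.natCard_primaryComponent_reduction_eq_pow`.)
[cite: GreenbergLNM1716, Thm. 4.1 (p. 102), §4 pp. 104–108] -/
theorem charValue_rankZero_of_reverse (p : ℕ) [hp : Fact p.Prime] (W : WeierstrassCurve ℚ)
    [W.IsGloballyMinimal] [W.IsElliptic] (hgo : GoodOrd W p) (κ : ZpExtension ℚ p) (hκ : κ.IsCyclotomic)
    {γ : absoluteGaloisGroup ℚ} (hγ : κ.IsTopGenerator γ) (D : W.SelmerDualData κ γ) [Finite (W.selmerGroupPInfty p)]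
    (S : Finset (HeightOneSpectrum (𝓞 ℚ))) (hS : ∀ v ∉ S, ((p : ℕ) : 𝓞 ℚ) ∉ v.asIdeal ∧ W.HasGoodReductionAt v)
    (v₀ : HeightOneSpectrum (𝓞 ℚ)) (hv₀ : v₀ ∉ S)
    (hrev : Nat.card (W.KerG κ 0) *
        Nat.card (AddCommGroup.primaryComponent
            (discreteH1 (localSubgroup (⊤ : Subgroup (absoluteGaloisGroup ℚ)) (v₀.adicCompletion ℚ))
              (localPoints W (v₀.adicCompletion ℚ))) p ⧸
          (AddSubgroup.map (W.localResOver p ⊤ (v₀.adicCompletion ℚ))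
            (unramifiedOutside (⊤ : Subgroup (absoluteGaloisGroup ℚ)) (W.geomPrimaryTorsion p) p
                ((↑S : Set (HeightOneSpectrum (𝓞 ℚ))) ∪ {v₀}) ⊓
              (⨅ v ∈ S, W.localKerOver p ⊤ (v.adicCompletion ℚ)) ⊓
              (⨅ w : InfinitePlace ℚ, W.localKerOver p ⊤ w.Completion))).addSubgroupOf
            (AddCommGroup.primaryComponent
              (discreteH1 (localSubgroup (⊤ : Subgroup (absoluteGaloisGroup ℚ)) (v₀.adicCompletion ℚ))
                (localPoints W (v₀.adicCompletion ℚ))) p)) ≤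
      (∏ v ∈ S, Nat.card (W.localTowerKerPrimary κ (v.adicCompletion ℚ) 0)) *
        Nat.card (EndCoinvariants (W.conjSelmerInfty κ γ - 1)))
    (fE : IwasawaAlgebra p) (hf : D.charIdeal = Ideal.span {fE}) :
    ∃ u : ℤ_[p]ˣ,
      ((PowerSeries.constantCoeff fE : ℤ_[p]) : ℚ_[p]) *
          (Nat.card (AddCommGroup.primaryComponent W.toAffine.Point p) : ℚ_[p]) ^ 2 =
        ((u : ℤ_[p]) : ℚ_[p]) * (p : ℚ_[p]) ^ (padicValNat p W.tamagawaProduct) *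
          (Nat.card (AddCommGroup.primaryComponent
            ((integralModelInt W).map (Int.castRingHom (ZMod p))).toAffine.Point p) : ℚ_[p]) ^ 2 *
          (Nat.card (W.selmerGroupPInfty p) : ℚ_[p]) := by
  obtain ⟨-, -, u, hu⟩ := constantCoeff_mul_sq_eq_printed_of_reverse p W hgo κ hκ hγ D S hS v₀ hv₀ hrev fE hf
  refine ⟨u, ?_⟩
  rw [InputsGreenbergCharValue.natCard_primaryComponent_reduction_eq_pow W p]
  have h := congrArg ((↑) : ℤ_[p] → ℚ_[p]) hu
  push_cast at h ⊢
  rw [h]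

/-! ## §3 `p = 2`: the display `X5.O1.TwoAdicEulerCharRankZero W 0` from the reverse inequality -/

open Summit.BirchSwinnertonDyer.Rank1Residual.X5.O1 in
/-- **`hEC` modulo the reverse inequality, rational `2`-torsion ALLOWED.** For `W/ℚ` globally minimal and elliptic: if for the
good ordinary `2`, every cyclotomic `ℤ₂`-extension datum `(κ, γ)` and finite `Sel_{2^∞}(E/ℚ)` there are `S ⊇ {bad} ∪ {2}` and
`v₀ ∉ S` with REV(W, 2, κ, γ, S, v₀) (Lemma 4.7 «`≤`» at `v₀` — part 9 derives it from Lemma 4.6 on `Γ`-invariants), then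
Greenberg's rank-`0` Euler-characteristic formula at `2` holds in the tree's display shape `TwoAdicEulerCharRankZero W 0` (the
`hEC` binder of the X5.O1 α-go doors). On {`E(ℚ)[2] = 0`} the display is unconditional (GEN 25
`GreenbergEulerChar.twoAdicEulerCharRankZero_of_noTwoTorsion`). [cite: GreenbergLNM1716, Thm. 4.1 (p. 102), §4 pp. 104–108] -/
theorem twoAdicEulerCharRankZero_of_reverse (W : WeierstrassCurve ℚ) [W.IsElliptic] [W.IsGloballyMinimal]
    (hrev : GoodOrd W 2 → ∀ (κ : ZpExtension ℚ 2) (γ : absoluteGaloisGroup ℚ), κ.IsCyclotomic → κ.IsTopGenerator γ →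
      Finite (W.selmerGroupPInfty 2) →
      ∃ (S : Finset (HeightOneSpectrum (𝓞 ℚ))) (v₀ : HeightOneSpectrum (𝓞 ℚ)),
        (∀ v ∉ S, ((2 : ℕ) : 𝓞 ℚ) ∉ v.asIdeal ∧ W.HasGoodReductionAt v) ∧ v₀ ∉ S ∧
        Nat.card (W.KerG κ 0) *
        Nat.card (AddCommGroup.primaryComponent
            (discreteH1 (localSubgroup (⊤ : Subgroup (absoluteGaloisGroup ℚ)) (v₀.adicCompletion ℚ))
              (localPoints W (v₀.adicCompletion ℚ))) 2 ⧸
          (AddSubgroup.map (W.localResOver 2 ⊤ (v₀.adicCompletion ℚ))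
            (unramifiedOutside (⊤ : Subgroup (absoluteGaloisGroup ℚ)) (W.geomPrimaryTorsion 2) 2
                ((↑S : Set (HeightOneSpectrum (𝓞 ℚ))) ∪ {v₀}) ⊓
              (⨅ v ∈ S, W.localKerOver 2 ⊤ (v.adicCompletion ℚ)) ⊓
              (⨅ w : InfinitePlace ℚ, W.localKerOver 2 ⊤ w.Completion))).addSubgroupOf
            (AddCommGroup.primaryComponent
              (discreteH1 (localSubgroup (⊤ : Subgroup (absoluteGaloisGroup ℚ)) (v₀.adicCompletion ℚ))
                (localPoints W (v₀.adicCompletion ℚ))) 2)) ≤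
      (∏ v ∈ S, Nat.card (W.localTowerKerPrimary κ (v.adicCompletion ℚ) 0)) *
        Nat.card (EndCoinvariants (W.conjSelmerInfty κ γ - 1))) :
    TwoAdicEulerCharRankZero W 0 := by
  intro hord κ γ hκ hγ _ D _ _ fE hfE hSel
  haveI := hSel
  have hgo : GoodOrd W 2 := hord
  obtain ⟨S, v₀, hS, hv₀, hr⟩ := hrev hgo κ γ hκ hγ hSel
  obtain ⟨u, hu⟩ := charValue_rankZero_of_reverse 2 W hgo κ hκ hγ D S hS v₀ hv₀ hr fE hfE
  refine ⟨u, ?_⟩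
  rw [hu, add_zero, zpow_natCast, Nat.cast_ofNat]

/-! ## §4 The NON-SPLIT multiplicative display (`l_v = 2` at `p = 2`) -/

/-- **The TWO-SIDED display at a NON-SPLIT `2`, ANY rational `2`-torsion, modulo the reverse inequality at one auxiliary place:**
for `W/ℚ` globally minimal and elliptic, non-split multiplicative at `2`, `κ` the cyclotomic `ℤ₂`-extension with topological
generator `γ`, `Sel_{2^∞}(E/ℚ)` finite, `D` a dual datum with `char X = (f)`, `S ⊇ {bad} ∪ {2}`, `v₀ ∉ S`, REV(W, 2, κ, γ, S, v₀):
**`f(0) · #E(ℚ)(2)² = u · 2^{ord₂ ∏_ℓ c_ℓ + 1} · #Sel_{2^∞}(E/ℚ)` with `u ∈ ℤ₂ˣ`** — EXACTLY the printed display («If p = 2, then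
|ker(r_v)| = 2c_v^{(p)}»: GEN 30 `MultTowerNS2LayerZero.natCard_localTowerKerPrimary_zero_eq_nonsplitTwo` at `v ∋ 2`, Lemma 3.3
exact at `v ∤ 2`). [cite: GreenbergLNM1716, Thm. 4.1 (p. 102), §3 Lemma 3.3 (pp. 86–87), p. 93, §4 pp. 104–108, 112–113] -/
theorem constantCoeff_mul_sq_eq_two_nonsplit_of_reverse (W : WeierstrassCurve ℚ) [W.IsGloballyMinimal] [W.IsElliptic]
    (hmult : W.HasMultiplicativeReductionAtPrime 2) (hns : ¬ W.HasSplitMultiplicativeReductionAtPrime 2)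
    (κ : ZpExtension ℚ 2) (hκ : κ.IsCyclotomic) {γ : absoluteGaloisGroup ℚ} (hγ : κ.IsTopGenerator γ)
    (D : W.SelmerDualData κ γ) [Finite (W.selmerGroupPInfty 2)]
    (S : Finset (HeightOneSpectrum (𝓞 ℚ))) (hS : ∀ v ∉ S, ((2 : ℕ) : 𝓞 ℚ) ∉ v.asIdeal ∧ W.HasGoodReductionAt v)
    (v₀ : HeightOneSpectrum (𝓞 ℚ)) (hv₀ : v₀ ∉ S)
    (hrev : Nat.card (W.KerG κ 0) *
        Nat.card (AddCommGroup.primaryComponent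
            (discreteH1 (localSubgroup (⊤ : Subgroup (absoluteGaloisGroup ℚ)) (v₀.adicCompletion ℚ))
              (localPoints W (v₀.adicCompletion ℚ))) 2 ⧸
          (AddSubgroup.map (W.localResOver 2 ⊤ (v₀.adicCompletion ℚ))
            (unramifiedOutside (⊤ : Subgroup (absoluteGaloisGroup ℚ)) (W.geomPrimaryTorsion 2) 2
                ((↑S : Set (HeightOneSpectrum (𝓞 ℚ))) ∪ {v₀}) ⊓
              (⨅ v ∈ S, W.localKerOver 2 ⊤ (v.adicCompletion ℚ)) ⊓
              (⨅ w : InfinitePlace ℚ, W.localKerOver 2 ⊤ w.Completion))).addSubgroupOf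
            (AddCommGroup.primaryComponent
              (discreteH1 (localSubgroup (⊤ : Subgroup (absoluteGaloisGroup ℚ)) (v₀.adicCompletion ℚ))
                (localPoints W (v₀.adicCompletion ℚ))) 2)) ≤
      (∏ v ∈ S, Nat.card (W.localTowerKerPrimary κ (v.adicCompletion ℚ) 0)) *
        Nat.card (EndCoinvariants (W.conjSelmerInfty κ γ - 1)))
    (f : IwasawaAlgebra 2) (hf : Module.charIdeal (IwasawaAlgebra 2) D.X = Ideal.span {f}) :
    Module.Finite (IwasawaAlgebra 2) D.X ∧ Module.IsTorsion (IwasawaAlgebra 2) D.X ∧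
      ∃ u : ℤ_[2]ˣ, PowerSeries.constantCoeff f *
          (Nat.card (AddCommGroup.primaryComponent W.toAffine.Point 2) : ℤ_[2]) ^ 2 =
        (u : ℤ_[2]) * (2 ^ (padicValNat 2 W.tamagawaProduct + 1) : ℕ) * Nat.card (W.selmerGroupPInfty 2) := by
  -- adapted from `constantCoeff_mul_sq_eq_two_nonsplit_of_defect` (GEN 31 part 4, §2) with a unit
  obtain ⟨hFG, hX, u, hu⟩ := constantCoeff_mul_sq_eq_nonsplit_rat_of_reverse 2 W hmult hns κ hκ hγ D S hS v₀ hv₀ hrev f hf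
  refine ⟨hFG, hX, u, ?_⟩
  rw [hu, mul_assoc, mul_assoc, mul_comm (Nat.card (W.selmerGroupPInfty 2) : ℤ_[2])]
  congr 2
  -- the place `v₂` of `2` lies in `S`
  set v₂ : HeightOneSpectrum (𝓞 ℚ) := Rat.HeightOneSpectrum.primesEquiv.symm ⟨2, Nat.prime_two⟩ with hv₂def
  have hv₂ : ((2 : ℕ) : 𝓞 ℚ) ∈ v₂.asIdeal := by
    have h := Rat.HeightOneSpectrum.natCast_natGenerator_mem v₂
    have hgen : Rat.HeightOneSpectrum.natGenerator v₂ = 2 := by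
      change ((Rat.HeightOneSpectrum.primesEquiv v₂ : Nat.Primes) : ℕ) = 2
      rw [hv₂def, Equiv.apply_symm_apply]
    rwa [hgen] at h
  have hv₂S : v₂ ∈ S := by
    by_contra h
    exact (hS v₂ h).1 hv₂
  have hgoodS : ∀ v ∉ S, W.HasGoodReductionAt v := fun v hv ↦ (hS v hv).2
  -- evaluate the local orders
  let c : HeightOneSpectrum (𝓞 ℚ) → ℕ := fun v ↦
    (W.baseChange (v.adicCompletion ℚ)).localTamagawaNumber (v.adicCompletionIntegers ℚ)
  have hsplit := Finset.mul_prod_erase S (fun v ↦ Nat.card (W.localTowerKerPrimary κ (v.adicCompletion ℚ) 0)) hv₂S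
  have hne : ∀ v ∈ S.erase v₂, ((2 : ℕ) : 𝓞 ℚ) ∉ v.asIdeal := fun v hv hpv ↦
    (Finset.mem_erase.mp hv).1 (eq_of_natCast_mem Nat.prime_two hpv hv₂)
  have herase : ∏ v ∈ S.erase v₂, Nat.card (W.localTowerKerPrimary κ (v.adicCompletion ℚ) 0) =
      2 ^ ∑ v ∈ S.erase v₂, padicValNat 2 (c v) := by
    rw [← Finset.prod_pow_eq_pow_sum]
    refine Finset.prod_congr rfl fun v hv ↦ ?_
    exact Rank1Residual.Additive.natCard_localTowerKerPrimary_zero_eq_pow_of_isCyclotomic W hκ (hne v hv)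
  -- `∑_{v ∈ S} ord₂ c_v = ord₂ ∏_ℓ c_ℓ`
  have htam : W.tamagawaProduct = ∏ v ∈ S, c v := by
    have hsupp : (Function.mulSupport c) ⊆ (S : Set (HeightOneSpectrum (𝓞 ℚ))) := by
      intro v hv
      by_contra hvS
      exact hv (W.localTamagawaNumber_eq_one_of_hasGoodReductionAt_holds v (hgoodS v hvS))
    change ∏ᶠ v, c v = _
    rw [finprod_eq_prod_of_mulSupport_subset c hsupp]
  have hsum : padicValNat 2 (c v₂) + ∑ v ∈ S.erase v₂, padicValNat 2 (c v) = padicValNat 2 W.tamagawaProduct := by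
    rw [htam, padicValNat_prod 2 _ c fun v _ ↦ localTamagawaNumber_ne_zero_rat W v, ← Finset.add_sum_erase S _ hv₂S]
  have hc₂ : Nat.card (W.localTowerKerPrimary κ (v₂.adicCompletion ℚ) 0) = 2 ^ (padicValNat 2 (c v₂) + 1) :=
    MultTowerNS2LayerZero.natCard_localTowerKerPrimary_zero_eq_nonsplitTwo W hmult hns hκ v₂ hv₂
  rw [← hsplit, herase, hc₂, ← pow_add, ← hsum]
  ring_nf

open Summit.BirchSwinnertonDyer.Rank1Residual.X5.O1 in
/-- **The display `X5.O1.TwoAdicEulerCharRankZeroNonsplitMult W 0` modulo the reverse inequality, rational `2`-torsion ALLOWED.**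
For `W/ℚ` globally minimal and elliptic: if at the non-split multiplicative `2`, for every cyclotomic `ℤ₂`-extension datum
`(κ, γ)` and finite `Sel_{2^∞}(E/ℚ)`, there are `S ⊇ {bad} ∪ {2}` and `v₀ ∉ S` with REV(W, 2, κ, γ, S, v₀), then Greenberg's
«analogue of Thm. 4.1» at `2` holds in the tree's display shape (`f_E(0)·#E(ℚ)(2)² = u·2^{ord₂ ∏_ℓ c_ℓ + 1}·#Sel`). On
{`E(ℚ)[2] = 0`} the display is unconditional (GEN 30). [cite: GreenbergLNM1716, §4 pp. 112–113; §3 p. 93] -/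
theorem twoAdicEulerCharRankZeroNonsplitMult_of_reverse (W : WeierstrassCurve ℚ) [W.IsElliptic] [W.IsGloballyMinimal]
    (hrev : W.HasMultiplicativeReductionAtPrime 2 → ¬ W.HasSplitMultiplicativeReductionAtPrime 2 →
      ∀ (κ : ZpExtension ℚ 2) (γ : absoluteGaloisGroup ℚ), κ.IsCyclotomic → κ.IsTopGenerator γ →
      Finite (W.selmerGroupPInfty 2) →
      ∃ (S : Finset (HeightOneSpectrum (𝓞 ℚ))) (v₀ : HeightOneSpectrum (𝓞 ℚ)),
        (∀ v ∉ S, ((2 : ℕ) : 𝓞 ℚ) ∉ v.asIdeal ∧ W.HasGoodReductionAt v) ∧ v₀ ∉ S ∧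
        Nat.card (W.KerG κ 0) *
        Nat.card (AddCommGroup.primaryComponent
            (discreteH1 (localSubgroup (⊤ : Subgroup (absoluteGaloisGroup ℚ)) (v₀.adicCompletion ℚ))
              (localPoints W (v₀.adicCompletion ℚ))) 2 ⧸
          (AddSubgroup.map (W.localResOver 2 ⊤ (v₀.adicCompletion ℚ))
            (unramifiedOutside (⊤ : Subgroup (absoluteGaloisGroup ℚ)) (W.geomPrimaryTorsion 2) 2
                ((↑S : Set (HeightOneSpectrum (𝓞 ℚ))) ∪ {v₀}) ⊓
              (⨅ v ∈ S, W.localKerOver 2 ⊤ (v.adicCompletion ℚ)) ⊓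
              (⨅ w : InfinitePlace ℚ, W.localKerOver 2 ⊤ w.Completion))).addSubgroupOf
            (AddCommGroup.primaryComponent
              (discreteH1 (localSubgroup (⊤ : Subgroup (absoluteGaloisGroup ℚ)) (v₀.adicCompletion ℚ))
                (localPoints W (v₀.adicCompletion ℚ))) 2)) ≤
      (∏ v ∈ S, Nat.card (W.localTowerKerPrimary κ (v.adicCompletion ℚ) 0)) *
        Nat.card (EndCoinvariants (W.conjSelmerInfty κ γ - 1))) :
    TwoAdicEulerCharRankZeroNonsplitMult W 0 := by
  intro hmult hns κ γ hκ hγ _ D _ _ fE hfE hSel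
  haveI := hSel
  obtain ⟨S, v₀, hS, hv₀, hr⟩ := hrev hmult hns κ γ hκ hγ hSel
  obtain ⟨-, -, u, hu⟩ := constantCoeff_mul_sq_eq_two_nonsplit_of_reverse W hmult hns κ hκ hγ D S hS v₀ hv₀ hr fE hfE
  refine ⟨u, ?_⟩
  have h2 : ((2 : ℤ_[2]) : ℚ_[2]) = 2 := rfl
  have h := congrArg ((↑) : ℤ_[2] → ℚ_[2]) hu
  push_cast at h
  rw [h, add_zero, zpow_natCast]
  simp only [h2]

end Summit.BirchSwinnertonDyer.BirchSwinnertonDyer.Theorems.TorsionEulerChar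

end
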